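import Mathlib
import Summits.Ventures.PercRepro2.Defs
import Summits.Ventures.PercRepro2.Independence
import Summits.Ventures.PercRepro2.Harris
import Summits.Ventures.PercRepro2.Graph
import Summits.Ventures.PercRepro2.Exploration
import Summits.Ventures.PercRepro2.Events
import Summits.Ventures.PercRepro2.Statements
import Summits.Ventures.PercRepro2.FourFunctions
import Summits.Ventures.PercRepro2.Induced
import Summits.Ventures.PercRepro2.Frontier
import Summits.Ventures.PercRepro2.ObsIndependence
import Summits.Ventures.PercRepro2.BHK
import Summits.Ventures.PercRepro2.BHKEvents
import Summits.Ventures.PercRepro2.ClusterProperty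
import Summits.Ventures.PercRepro2.BHKPair
import Summits.Ventures.PercRepro2.CondAvoidPA
import Summits.Ventures.PercRepro2.CondAvoidZPA
import Summits.Ventures.PercRepro2.BoxUnionDefs
import Summits.Ventures.PercRepro2.BoxUnion
import Summits.Ventures.PercRepro2.BoxUnionPair
import Summits.Ventures.PercRepro2.PairTP2
import Summits.Ventures.PercRepro2.PairTP2Main
import Summits.Ventures.PercRepro2.UnionRowMech
import Summits.Ventures.PercRepro2.UnionRowMech2
import Summits.Ventures.PercRepro2.UnionRowGrid
import Summits.Ventures.PercRepro2.UnionRowGrid2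
import Summits.Ventures.PercRepro2.UnionRowCellDefs

/-!
# The two-status union row in the cell's own form, on every graph — part 2: the theorem
(blind cell PercRepro2, mine-1 g39; proofs/MINE1-UNIONROW2.md §7)

The grid theorems of `UnionRowGrid` / `UnionRowGrid2` are transported to the vocabulary of
`BoxUnionPair.hit_boxUnion_nonneg`: for an up-set `A` of the status grid, the observable
`obs A : Finset V → Finset V → ℝ`, `obs A W C = 1[(code W C u, code W C v) ∈ A]`, is increasing in
`C_s` and decreasing in `C_t` (`obs_zmono`); the expectation
`E[(obs A(σ) − E[obs A(σ) | Q]) (obs B(σ) − E[obs B(σ) | Q]) · 1_{Q ∩ ({s ↮ X} ∪ {t ↮ Y})}]`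
is `Z⁻²` times the grid sum over the union cells `U_XY` (`row_eq_gridRow`), and the grid sum is
nonnegative by the grid theorems in every case — `U_XY` always contains every cell but the two
double-hit cells, so the four union types are the four membership patterns of `(S,T), (T,S)` in
`U_XY` (`mem_unionCells_of_ne`).

**THEOREM** (`union_row_nonneg`): for `u ≠ v`, every finite graph, every admissible weight vector
with `P(s ↮ t) > 0`, all `X, Y ⊆ {u, v}` and all up-sets `A, B` of the status grid — outside the
two residual patterns when both double-hit cells are cut — the two-status union row of row
2′CON-U holds in the cell's own form.
-/

namespace Summit.Ventures.PercRepro2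

namespace UnionRowCell

open Finset UnionRowMech UnionRowGrid
open scoped Classical

variable {V : Type*} {E : Type*} [Fintype V] [DecidableEq V] [Fintype E] [DecidableEq E]
variable (ends : E → Sym2 V) (s t u v : V) {p : E → ℝ}

/-! ### The row in the cell's form is the grid row over the union cells -/

/-- The grid row over a set of cells `U`: `Σ_{k ∈ U} M(k)(1_A(k) − M(A)/Z)(1_B(k) − M(B)/Z)`. -/
noncomputable def gridRow (M : Grid → ℝ) (U A B : Finset Grid) : ℝ :=
  ∑ k ∈ U, M k * ((if k ∈ A then 1 else 0) - mass M A / total M) *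
    ((if k ∈ B then 1 else 0) - mass M B / total M)

/-- **Identification**: the union row in the cell's form, for the up-set observables of two
statuses and `X, Y ⊆ {u, v}`, is the grid row over the union cells. -/
theorem row_eq_gridRow (hne : u ≠ v) (A B : Finset Grid) {X Y : Finset V} (hX : X ⊆ {u, v})
    (hY : Y ⊆ {u, v}) :
    expect p (((connEvent ends s t)ᶜ ∩ ((hitEvent ends s X)ᶜ ∪ (hitEvent ends t Y)ᶜ)).indicator
      (fun ω =>
        (obs u v A (BoxUnionPair.status ends {u, v} s t ω).1
              (OrderDual.ofDual (BoxUnionPair.status ends {u, v} s t ω).2) -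
            BoxUnionPair.condMean p ends {u, v} s t
              (fun k => obs u v A k.1 (OrderDual.ofDual k.2))) *
          (obs u v B (BoxUnionPair.status ends {u, v} s t ω).1
              (OrderDual.ofDual (BoxUnionPair.status ends {u, v} s t ω).2) -
            BoxUnionPair.condMean p ends {u, v} s t
              (fun k => obs u v B k.1 (OrderDual.ofDual k.2))))) =
      gridRow (gridMass ends s t u v p) (unionCells u v X Y) A B := by
  set cA := BoxUnionPair.condMean p ends {u, v} s t
    (fun k => obs u v A k.1 (OrderDual.ofDual k.2)) with hcA
  set cB := BoxUnionPair.condMean p ends {u, v} s t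
    (fun k => obs u v B k.1 (OrderDual.ofDual k.2)) with hcB
  set φ : BoxUnionPair.ZLat V → ℝ := fun k =>
    (obs u v A k.1 (OrderDual.ofDual k.2) - cA) * (obs u v B k.1 (OrderDual.ofDual k.2) - cB)
    with hφ
  set S : Set (Config E) :=
    (connEvent ends s t)ᶜ ∩ ((hitEvent ends s X)ᶜ ∪ (hitEvent ends t Y)ᶜ) with hS
  -- the row as a sum against the status law over the box union
  have h12 : expect p (S.indicator (fun ω => φ (BoxUnionPair.status ends {u, v} s t ω))) =
      ∑ k, BoxUnionPair.pairLaw p ends {u, v} s t k *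
        (if (k.1 ∩ X = ∅ ∨ OrderDual.ofDual k.2 ∩ Y = ∅) then φ k else 0) := by
    rw [BoxUnionPair.sum_pairLaw_mul]
    unfold expect
    refine Finset.sum_congr rfl fun ω _ => ?_
    have hmem : (ω ∈ (connEvent ends s t)ᶜ ∧
        ((BoxUnionPair.status ends {u, v} s t ω).1 ∩ X = ∅ ∨
          OrderDual.ofDual (BoxUnionPair.status ends {u, v} s t ω).2 ∩ Y = ∅)) ↔ ω ∈ S := by
      rw [BoxUnionPair.status_fst_inter_eq_empty_iff ends {u, v} s t hX,
        BoxUnionPair.status_snd_inter_eq_empty_iff ends {u, v} s t hY]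
      simp only [hS, Set.mem_inter_iff, Set.mem_union, Set.mem_compl_iff]
    by_cases hQ : ω ∈ (connEvent ends s t)ᶜ
    · by_cases hU : (BoxUnionPair.status ends {u, v} s t ω).1 ∩ X = ∅ ∨
          OrderDual.ofDual (BoxUnionPair.status ends {u, v} s t ω).2 ∩ Y = ∅
      · rw [if_pos hQ, if_pos hU, Set.indicator_of_mem (hmem.1 ⟨hQ, hU⟩)]
      · rw [if_pos hQ, if_neg hU, Set.indicator_of_notMem (fun h => hU (hmem.2 h).2), mul_zero]
    · rw [if_neg hQ, Set.indicator_of_notMem (fun h => hQ (hmem.2 h).1), mul_zero]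
  rw [h12, sum_pairLaw_eq_grid ends s t u v hne]
  unfold gridRow unionCells
  rw [Finset.sum_filter]
  refine Finset.sum_congr rfl fun k _ => ?_
  have hk := mem_boxUnion_iota u v hne X Y k
  simp only [unionCells, Finset.mem_filter, Finset.mem_univ, true_and] at hk
  by_cases hU : ((u ∈ X → k.1 ≠ 2) ∧ (v ∈ X → k.2 ≠ 2)) ∨ ((u ∈ Y → k.1 ≠ 0) ∧ (v ∈ Y → k.2 ≠ 0))
  · rw [if_pos (hk.2 hU), if_pos hU]
    simp only [hφ, obs_iota u v hne, hcA, hcB, condMean_obs ends s t u v hne]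
    ring
  · rw [if_neg (fun h => hU (hk.1 h)), if_neg hU, mul_zero]

/-! ### The grid row over the union cells is nonnegative -/

/-- The `Z²`-scaled term of a cell. -/
noncomputable def term (M : Grid → ℝ) (A B : Finset Grid) (k : Grid) : ℝ :=
  M k * (total M * (if k ∈ A then 1 else 0) - mass M A) *
    (total M * (if k ∈ B then 1 else 0) - mass M B)

omit [Fintype V] [DecidableEq V] [Fintype E] [DecidableEq E] in
/-- The sum of the terms over all cells is `Z·(Z·M(A∩B) − M(A)M(B))`. -/
lemma sum_term_univ (M : Grid → ℝ) (A B : Finset Grid) :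
    ∑ k, term M A B k = total M * (total M * mass M (A ∩ B) - mass M A * mass M B) := by
  have hAB : ∀ k : Grid, (if k ∈ A then (1 : ℝ) else 0) * (if k ∈ B then 1 else 0) =
      if k ∈ A ∩ B then 1 else 0 := by
    intro k
    by_cases hA : k ∈ A <;> by_cases hB : k ∈ B <;> simp [hA, hB]
  have e1 : ∀ k : Grid, term M A B k = total M ^ 2 * (M k * (if k ∈ A ∩ B then 1 else 0)) -
      total M * mass M B * (M k * (if k ∈ A then 1 else 0)) -
      total M * mass M A * (M k * (if k ∈ B then 1 else 0)) + mass M A * mass M B * M k := by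
    intro k
    unfold term
    rw [← hAB k]
    ring
  simp_rw [e1]
  rw [Finset.sum_add_distrib, Finset.sum_sub_distrib, Finset.sum_sub_distrib, ← Finset.mul_sum,
    ← Finset.mul_sum, ← Finset.mul_sum, ← Finset.mul_sum]
  have hm : ∀ C : Finset Grid, ∑ k, M k * (if k ∈ C then (1 : ℝ) else 0) = mass M C := by
    intro C
    unfold mass
    simp_rw [mul_ite, mul_one, mul_zero]
    rw [← Finset.sum_filter, Finset.filter_mem_eq_inter, Finset.univ_inter]
  rw [hm, hm, hm]
  unfold total
  ring

omit [Fintype V] [DecidableEq V] [Fintype E] [DecidableEq E] in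
/-- The grid row over `U` is `Z⁻²` times the sum of the terms over `U`. -/
lemma gridRow_eq (M : Grid → ℝ) (U A B : Finset Grid) (hZ : total M ≠ 0) :
    gridRow M U A B = (∑ k ∈ U, term M A B k) / total M ^ 2 := by
  unfold gridRow term
  rw [Finset.sum_div]
  refine Finset.sum_congr rfl fun k _ => ?_
  field_simp

omit [Fintype V] [Fintype E] [DecidableEq E] in
/-- The sum of the terms over the union cells: all terms minus the cut double-hit cells. -/
lemma sum_term_unionCells (M : Grid → ℝ) (A B : Finset Grid) (X Y : Finset V) :
    ∑ k ∈ unionCells u v X Y, term M A B k =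
      ∑ k, term M A B k -
        (if UnionRowMech.ST ∈ unionCells u v X Y then 0 else term M A B UnionRowMech.ST) -
        (if TS ∈ unionCells u v X Y then 0 else term M A B TS) := by
  have hpt : ∀ k : Grid, (if k ∈ unionCells u v X Y then term M A B k else 0) =
      term M A B k -
        (if k = UnionRowMech.ST then
          (if UnionRowMech.ST ∈ unionCells u v X Y then 0 else term M A B UnionRowMech.ST)
          else 0) -
        (if k = TS then (if TS ∈ unionCells u v X Y then 0 else term M A B TS) else 0) := by
    intro k
    by_cases h1 : k = UnionRowMech.ST
    · subst h1
      have hne : UnionRowMech.ST ≠ TS := ST_ne_TS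
      by_cases hU : UnionRowMech.ST ∈ unionCells u v X Y
      · simp [hU, hne]
      · simp [hU, hne]
    · by_cases h2 : k = TS
      · subst h2
        have hne : TS ≠ UnionRowMech.ST := ST_ne_TS.symm
        by_cases hU : TS ∈ unionCells u v X Y
        · simp [hU, hne]
        · simp [hU, hne]
      · rw [if_pos (mem_unionCells_of_ne u v X Y h1 h2), if_neg h1, if_neg h2]
        ring
  have hsum : ∑ k ∈ unionCells u v X Y, term M A B k =
      ∑ k, if k ∈ unionCells u v X Y then term M A B k else 0 := by
    rw [Finset.sum_ite_mem, Finset.univ_inter]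
  rw [hsum]
  simp_rw [hpt]
  rw [Finset.sum_sub_distrib, Finset.sum_sub_distrib, Finset.sum_ite_eq', Finset.sum_ite_eq',
    if_pos (Finset.mem_univ _), if_pos (Finset.mem_univ _)]

/-! ### The theorem -/

/-- **The two-status union row in the cell's own form, on every graph**: for `u ≠ v`, every
admissible weight vector with `P(s ↮ t) > 0`, all `X, Y ⊆ {u, v}` and all up-set observables
`obs A, obs B` of the two statuses — outside the two residual patterns when both double-hit
cells are cut by the union event —
`E[(obs A(σ) − E[obs A(σ) | Q]) (obs B(σ) − E[obs B(σ) | Q]) · 1_{Q ∩ ({s ↮ X} ∪ {t ↮ Y})}] ≥ 0`. -/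
theorem union_row_nonneg (hne : u ≠ v) (hp : IsProbVec p)
    (hQ : 0 < prob p (connEvent ends s t)ᶜ) {X Y : Finset V} (hX : X ⊆ {u, v})
    (hY : Y ⊆ {u, v}) {A B : Finset Grid} (hA : IsUp A) (hB : IsUp B)
    (hres : UnionRowMech.ST ∈ unionCells u v X Y ∨ TS ∈ unionCells u v X Y ∨
      ¬ ((UnionRowMech.ST ∈ A ∧ UnionRowMech.ST ∈ B ∧ TS ∉ A ∧ TS ∉ B) ∨
        (TS ∈ A ∧ TS ∈ B ∧ UnionRowMech.ST ∉ A ∧ UnionRowMech.ST ∉ B))) :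
    0 ≤ expect p (((connEvent ends s t)ᶜ ∩ ((hitEvent ends s X)ᶜ ∪ (hitEvent ends t Y)ᶜ)).indicator
      (fun ω =>
        (obs u v A (BoxUnionPair.status ends {u, v} s t ω).1
              (OrderDual.ofDual (BoxUnionPair.status ends {u, v} s t ω).2) -
            BoxUnionPair.condMean p ends {u, v} s t
              (fun k => obs u v A k.1 (OrderDual.ofDual k.2))) *
          (obs u v B (BoxUnionPair.status ends {u, v} s t ω).1
              (OrderDual.ofDual (BoxUnionPair.status ends {u, v} s t ω).2) -
            BoxUnionPair.condMean p ends {u, v} s t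
              (fun k => obs u v B k.1 (OrderDual.ofDual k.2))))) := by
  rw [row_eq_gridRow ends s t u v hne A B hX hY]
  have hZ : 0 < total (gridMass ends s t u v p) := by
    rw [total_gridMass_eq]
    exact hQ
  rw [gridRow_eq _ _ A B hZ.ne', sum_term_unionCells, sum_term_univ]
  refine div_nonneg ?_ (sq_nonneg _)
  have hM0 := gridMass_nonneg ends s t u v hp
  by_cases h1 : UnionRowMech.ST ∈ unionCells u v X Y <;>
    by_cases h2 : TS ∈ unionCells u v X Y
  · rw [if_pos h1, if_pos h2, sub_zero, sub_zero]
    have := pa_Q ends s t u v hp A B hA hB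
    exact mul_nonneg hZ.le (by nlinarith)
  · rw [if_pos h1, if_neg h2, sub_zero]
    have := single_exclusion_generic hM0 (fun A hA h => up_subset_Ru hA h)
      (fun A hA h => down_subset_Rv' hA h) TS_notMem_Ru TS_notMem_Rv'
      (fun A B hA hB => pa_Q ends s t u v hp A B hA hB)
      (fun A B hA hB hAR hBR => pa_Ru ends s t u v hp A B hA hB hAR hBR)
      (fun A B hA hB hAR hBR => pa_Rv' ends s t u v hp A B hA hB hAR hBR) hA hB
    unfold term
    exact this
  · rw [if_neg h1, if_pos h2, sub_zero]
    have := single_exclusion_row ends s t u v hp hA hB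
    unfold term
    exact this
  · rw [if_neg h1, if_neg h2]
    have hres' : ¬ ((UnionRowMech.ST ∈ A ∧ UnionRowMech.ST ∈ B ∧ TS ∉ A ∧ TS ∉ B) ∨
        (TS ∈ A ∧ TS ∈ B ∧ UnionRowMech.ST ∉ A ∧ UnionRowMech.ST ∉ B)) := by
      rcases hres with h | h | h
      · exact absurd h h1
      · exact absurd h h2
      · exact h
    have := double_exclusion_row ends s t u v hp hA hB hres'
    unfold term
    exact this

end UnionRowCell

end Summit.Ventures.PercRepro2
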